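import Literature.NumberTheory.LFunctions.WeilTwoPrimeCellsT80Data0
import Literature.NumberTheory.LFunctions.WeilTwoPrimeCellsT80Data1
import Literature.NumberTheory.LFunctions.WeilTwoPrimeCellsT80Data2
import HarnessLib

/-!
# Two-prime minorant cells on `[0, 80]`: the chain and its level

The 248 cells of the certified piecewise-polynomial minorant of the two-prime Weil weight `w₂₃(t) = Re ψ(1/4+it/2) − √2 log 2 cos(t log 2) − (2 log 3/√3) cos(t log 3)` on `[0, 80]` at level `wL = 791673989981/549755813888` (format `TPDCell`, `WeilTwoPrimeCells.lean`; integer checker `TPDCell.checkZ 120 5`), shared by the two-prime odd-margin certificates E (`a₀ = 59/100`) and F (`a₀ = 63/100`) of crux stmt-RiemannHypothesis-1526 (lead c5). Generated by exact arithmetic mirroring the checker (`gen/cells23.py`): digamma value and coefficients are the extreme values allowed by the integer series, the ripple constants are the engine values; minorant gap ≤ 2·10⁻⁹ for `t ≤ 30`, ≤ 1.6·10⁻⁸ on `[0, 80]` (float validation). [cite: Yoshida1992, §6] Nothing is trusted: only kernel Booleans are consumed.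
-/

noncomputable section

namespace Literature.NumberTheory.LFunctions

/-- The 248 cells of the two-prime minorant on `[0, 80]`, chained from `0` to `80`. [folklore] -/
def weilTwoPrimeCellsT80 : List TPDCell :=
  weilTwoPrimeCellsT80C0 ++ weilTwoPrimeCellsT80C1 ++ weilTwoPrimeCellsT80C2

/-- The level `wL` of the two-prime minorant on `[0, 80]` (`wL + √2 log 2 + 2 log 3/√3 ≤ Re ψ(1/4 + i80/2)`). [folklore] -/
def weilTwoPrimeCellsT80Level : ℚ := 791673989981/549755813888

end Literature.NumberTheory.LFunctions
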